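import Summits.HodgeConjecture.HodgeConjecture.Theorems.BoundaryReadoutPullbackAlgebraicZbarBookkeeping
import Summits.HodgeConjecture.HodgeConjecture.Theorems.BoundaryReadoutPullbackAlgebraicCupDivisor
import Summits.HodgeConjecture.HodgeConjecture.Theorems.BoundaryReadoutPullbackAlgebraicBundlePullback
import Summits.HodgeConjecture.HodgeConjecture.Theorems.BoundaryReadoutPullbackAlgebraicBundleLerayHirsch
import Summits.HodgeConjecture.HodgeConjecture.Theorems.BoundaryReadoutPullbackAlgebraicLerayHirschReadout
import Summits.HodgeConjecture.HodgeConjecture.Theorems.BoundaryReadoutPullbackAlgebraicExceptionalDivisorLocallyTrivial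
import Summits.HodgeConjecture.HodgeConjecture.Theorems.BoundaryReadoutPullbackAlgebraicExceptionalDivisorSmoothProjective
import Summits.HodgeConjecture.HodgeConjecture.Theorems.PadicSemiregularLiftHodgeBeyondAnchorsDiagonalPullback
import Literature.AlgebraicTopology.CharacteristicClasses.ProjectiveSpaceLerayHirsch
import HarnessLib

/-!
# Line `normal_cone` — crux `PullbackAlgebraic` (stmt-HodgeConjecture-1071) by DEFORMATION TO THE
# NORMAL CONE in coniveau form (Fulton 1998, Ch. 5–6 and §19.2) — reshape 2: the CONSTANT-LIFT skeleton

Crux (verbatim the shared route decl, primary `QbarEnvelope.PullbackAlgebraic`, also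
`BoundaryReadout.PullbackAlgebraic`): for every `ℂ`-morphism `ι : X ⟶ W` of smooth projective complex
varieties, `ι^*(Nᵖ H²ᵖ(W(ℂ); ℂ)) ⊆ Nᵖ H²ᵖ(X(ℂ); ℂ)` on the tree's support carrier `algebraicClasses`.

## FINAL STATE (2026-08-17T17:15Z): ALL STUBS LANDED, crux PROVED — closing file Theorems/BoundaryReadoutPullbackAlgebraic.lean
## (p171366, commit b5f347573de8: `boundaryReadout_pullbackAlgebraic_proof`, `pullbackAlgebraic_qbarEnvelope_proof`,
## `fulton1998_map_mem_algebraicClasses_holds`). This workfile is the sorry-free skeleton of record (primed names to avoid clashes).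

## State of the line (lead prover-line-stmt-HodgeConjecture-1071-0, 2026-08-17, cycle 1 — reshape 2)

The first reshape split the section pull-back into four sub-stubs; ALL FOUR LANDED
(`Theorems/BoundaryReadoutPullbackAlgebraic{CupDivisor,BundlePullback,BundleLerayHirsch,LerayHirschReadout}`),
so `s^*(Nᵖ(E)) ⊆ Nᵖ(X)` for the section of a Zariski-locally trivial `ℙʳ`-bundle is a THEOREM
(`sectionPullback` below; also proposed as `Theorems/…SectionPullback`). Meanwhile seat
BoundaryReadout-2 landed the CONSTANT-LIFT composition (`Theorems/…ConstantLift`: lift `c` along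
`φ = β ≫ pr_Y : M → Y` instead of through a specialisation line — Deligne + Hironaka decompose
`φ^* c = w + k_* u` with `w` dying off `Z̄ = closure(φ⁻¹Z ∖ k(E))`; the `t₀`-slice misses `k(E)`; slice
homotopy; section pull-back), which kills the former `stub_specializationLine` (a multiplicity statement)
together with `e`, `ρ` and the irreducible closures, and CONSTRUCTED the datum
(`Theorems/…DeformationDatum`: `T = ℙ¹`, `M = Bl_{X × {t₁}}(Y ⊗ T)` by
`Resolution.exists_isBlowup_ker_isSmoothProjective`, `J` = strict transform through the universal
property (`isEffectiveCartier_ker_sliceAt`), `E = M ×_{Y ⊗ T} X`, `s = (ι_{t₁} ≫ J, 𝟙)`) MODULO three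
inputs, two of which are the stubs of this skeleton:

* `stub_exceptionalDivisorLocallyTrivial` — the named fact
  `Resolution.Hartshorne1977_exceptionalDivisor_locallyTrivial` (Hartshorne II 8.24 (b) + 8.17: the
  exceptional divisor `B ×_V Z → Z` of ANY blowing up of a smooth projective `V` along a smooth closed
  `Z` is Zariski-locally over `Z` a product `U × ℙʳ`), universe `0`;
* `stub_exceptionalDivisorSmoothProjective` — GRANTED that local triviality, the exceptional divisor is a
  smooth projective variety of dimension `dim Z + r` (smooth over `Z` of relative dimension `r`, closed
  in the projective `B`, irreducible: open surjective `q` with irreducible fibres over an irreducible base);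
(the third input, the codimension bookkeeping of `Z̄ Z = closure(φ⁻¹ Z ∖ k(E))`, was LANDED by seat
BoundaryReadout-2 as `zbar_coheight_bookkeeping`, `Theorems/…ZbarBookkeeping`, and is used directly).

Composition (REAL proof, no `sorry` below the stubs): `PullbackAlgebraic_of_exceptionalDivisor` (landed,
`Theorems/…DeformationDatum`) fed with the two stubs, the landed bookkeeping and the section pull-back theorem.

Disproof used: `Cruxes/PullbackAlgebraic/Disproof.lean` (cdisprove cycle 1, 2026-08-17T14:47Z): NO KILL;
all stubs of `normal_cone` TRUE as typed; flagged the `b' < b` trap of the readout (handled by the landed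
`complexGysin_cupProduct_map_eq_zero_of_lt`) and that `stub_specializationLine`'s hypotheses were
load-bearing — that stub is now GONE (constant lift).
-/

noncomputable section

-- `Summit.HodgeConjecture.HodgeConjecture.…` is the mandated namespace (single-conjunct summit).
set_option linter.dupNamespace false

namespace Summit.HodgeConjecture.HodgeConjecture.Cruxes.PullbackAlgebraic.NormalCone

open CategoryTheory CategoryTheory.Limits AlgebraicGeometry MonoidalCategory CartesianMonoidalCategory
open Literature.AlgebraicGeometry Literature.AlgebraicGeometry.Motives Literature.AlgebraicGeometry.Resolution
open Literature.AlgebraicGeometry.HodgeTheory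
open Literature.AlgebraicTopology.SingularHomology (cupProduct cupProduct_one cupProduct_assoc
  cupProduct_map cupProduct_gradedComm_holds singularCohomology.one)
open Literature.AlgebraicTopology.CharacteristicClasses (cupPow cupPow_zero cupPow_succ map_cupPow)
open Summit.HodgeConjecture.HodgeConjecture.Theorems
open Summit.HodgeConjecture.HodgeConjecture.Theorems.PullbackAlgebraicNormalCone

/-- **Stub A — the exceptional divisor of the blowing up of a smooth projective variety along a smooth
closed subvariety is a Zariski-locally trivial `ℙʳ`-bundle over the centre** (the tree's named fact
`Resolution.Hartshorne1977_exceptionalDivisor_locallyTrivial`, Hartshorne II Thm. 8.24 (b) with II 8.17;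
Liu Thm. 8.1.19 (b)): for smooth projective `V`, `Z` of dimensions `m + r + 1`, `m`, a closed immersion
`i : Z ⟶ V` and ANY blowing up `β : B ⟶ V` along `ker i`, every point of `Z` has a Zariski-open `U` over
which `E = B ×_V Z →(pr₂) Z` is `U`-isomorphic to `U × ℙʳ → U`. Route to a proof: locally on an affine
open `Spec R ⊆ V` the ideal of `Z` is generated by a regular sequence `x₀, …, x_r` (smooth in smooth:
`RegularCentreLocal`), `B|_{Spec R} ≅ Proj R[It]` (uniqueness of blowing ups, `IsBlowup`), and
`E|_{Spec R} = Proj (⊕ Iⁿ/Iⁿ⁺¹) = Proj (R/I)[T₀, …, T_r] = Spec (R/I) × ℙʳ` (quasi-regularity: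
`gr_I R ≅ (R/I)[T]`; chartwise `(R[It])_{(xᵢt)} ⧸ (xᵢ) ≅ (R ⧸ I)[Tⱼ : j ≠ i]`, the tree's
`BlowupChartQuasiRegular` / `ExceptionalDivisorRegular`, glued over the `r + 1` charts). Size: L.
[Hartshorne1977 II 8.24 (b), II 8.17; Liu2002 Thm. 8.1.19 (b); Fulton1998 B.6.9, B.7.1] -/
theorem stub_exceptionalDivisorLocallyTrivial' :
    Hartshorne1977_exceptionalDivisor_locallyTrivial.{0} :=
  -- LANDED: Theorems/BoundaryReadoutPullbackAlgebraicExceptionalDivisorLocallyTrivial.lean (p171244),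
  -- Literature discharge Resolution.Hartshorne1977_exceptionalDivisor_locallyTrivial_holds (p170931)
  stub_exceptionalDivisorLocallyTrivial

/-- **Stub B — granted its Zariski-local triviality, the exceptional divisor is a smooth projective
variety of dimension `dim Z + r`** (Hartshorne II 8.24 (b); Fulton 1998 B.6.9): for `i : Z ⟶ V` a closed
immersion of smooth projective varieties of dimensions `m`, `m + r + 1` and any blowing up `β : B ⟶ V`
along `ker i`, the `ℂ`-scheme `E = B ×_V Z` (structure map through `pr₂` and `Z`) is smooth projective of
dimension `m + r`: it is smooth of relative dimension `r` over `Z` (locally `U × ℙʳ`), hence smooth of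
relative dimension `m + r` over `ℂ`; projective as a closed subscheme (`pr₁`, base change of the closed
immersion `i`) of `B`, which is projective (`IsBlowup.isSmoothProjective`); geometrically irreducible
because `pr₂ : E → Z` is open (flat, locally a product) and surjective with irreducible fibres `ℙʳ` over
the irreducible `Z`. Size: M. [Hartshorne1977 II 8.24 (b); Fulton1998 App. B.6.9] -/
theorem stub_exceptionalDivisorSmoothProjective' :
    Hartshorne1977_exceptionalDivisor_locallyTrivial.{0} →
    ∀ ⦃m r : ℕ⦄ ⦃V Z B : SchemeOver ℂ⦄ (i : Z ⟶ V) (β : B ⟶ V),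
      IsSmoothProjective (m + r + 1) V → IsSmoothProjective m Z → IsClosedImmersion i.left →
      IsBlowup β.left i.left.ker →
      IsSmoothProjective (m + r) (Over.mk (pullback.snd β.left i.left ≫ Z.hom) : SchemeOver ℂ) :=
  -- LANDED: Theorems/BoundaryReadoutPullbackAlgebraicExceptionalDivisorSmoothProjective.lean (p169558)
  stub_exceptionalDivisorSmoothProjective

/-! ### The composition (real proofs, no `sorry` below this line) -/

section SectionPullback

variable {n : ℕ} {X : SchemeOver ℂ}

/-- Cup product with POWERS of a divisor class keeps algebraic classes algebraic:
`a ∈ Nˡ H²ˡ`, `d ∈ N¹ H²` ⟹ `a ∪ dʲ ∈ Nˡ⁺ʲ` (iterate the landed `stub_cupDivisor`).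
[Fulton1998 §2.3; VoisinHodgeII2003 Prop. 9.20] -/
theorem cupProduct_cupPow_mem_algebraicClasses' (hX : IsSmoothProjective n X)
    {d : complexBetti X (2 * 1)} (hd : d ∈ algebraicClasses X 1) {l : ℕ} {a : complexBetti X (2 * l)}
    (ha : a ∈ algebraicClasses X l) :
    ∀ (j m : ℕ) (_ : l + j = m) (h : 2 * l + 2 * j = 2 * m),
      cupProduct h a (cupPow ℂ d j) ∈ algebraicClasses X m
  | 0, m, hm, h => by
    subst hm
    have h1 : cupProduct h a (cupPow ℂ d 0) = a := cupProduct_one a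
    rw [h1]
    exact ha
  | j + 1, m, hm, h => by
    subst hm
    have ih := cupProduct_cupPow_mem_algebraicClasses' hX hd ha j (l + j) rfl (by omega)
    rw [cupPow_succ, ← cupProduct_assoc (show 2 * l + 2 * j = 2 * (l + j) by omega)
      (show 2 * j + 2 = 2 * (j + 1) by omega) (show 2 * (l + j) + 2 * 1 = 2 * (l + j + 1) by omega)]
    exact stub_cupDivisor hX (l + j) _ d ih hd

/-- **The section of a Zariski-locally trivial `ℙʳ`-bundle pulls algebraic classes back to algebraic
classes** — the former `stub_sectionPullback`, a real proof from the four LANDED sub-stubs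
(`stub_cupDivisor`, `stub_bundlePullback`, `stub_bundleLerayHirsch`, `stub_lerayHirschReadout`):
`s^* y = Σ_b (s^* ζ)ᵇ ∪ x_b` with every `x_b ∈ N^{p-b}` and `s^* ζ ∈ N¹`.
[Fulton1998 Thm. 3.3 (b), Prop. 6.1; VoisinHodgeI2002 Lemma 7.32] -/
theorem sectionPullback' {r : ℕ} {E : SchemeOver ℂ} (q : E ⟶ X) (s : X ⟶ E)
    (hX : IsSmoothProjective n X) (hE : IsSmoothProjective (n + r) E) (hsq : s ≫ q = 𝟙 X)
    (htriv : ∀ x : X.left, ∃ U : X.left.Opens, x ∈ U ∧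
      ∃ φ : (Over.mk ((q.left ⁻¹ᵁ U).ι ≫ E.hom) : SchemeOver ℂ) ≅
          (Over.mk (U.ι ≫ X.hom) : SchemeOver ℂ) ⊗ Motives.projectiveSpace r ℂ,
        φ.hom.left ≫ (fst (Over.mk (U.ι ≫ X.hom) : SchemeOver ℂ)
          (Motives.projectiveSpace r ℂ)).left ≫ U.ι = (q.left ⁻¹ᵁ U).ι ≫ q.left)
    (p : ℕ) {y : complexBetti E (2 * p)} (hy : y ∈ algebraicClasses E p) :
    complexBetti.map s (2 * p) y ∈ algebraicClasses X p := by
  -- an orientation family (complex points of smooth projective varieties are orientable)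
  let μ : OrientationFamily := fun _ _ h ↦ (Motives.ComplexPoints.isOrientableOver ℂ h).some
  obtain ⟨ζ, hζ, ⟨c, hc, hgys⟩, hexp⟩ := stub_bundleLerayHirsch μ q hX hE htriv
  obtain ⟨x, hx⟩ := hexp p y
  -- the coefficients of `y` are algebraic
  have hxalg : ∀ b : Fin (min r p + 1), x b ∈ algebraicClasses X (p - (b : ℕ)) :=
    stub_lerayHirschReadout μ q hX hE (stub_bundlePullback q hX hE htriv) stub_cupDivisor ζ hζ c hc
      hgys p x (hx ▸ hy)
  -- `s^* q^* = 𝟙`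
  have hsq' : ∀ (k : ℕ) (z : complexBetti X k), complexBetti.map s k (complexBetti.map q k z) = z := by
    intro k z
    rw [← CategoryTheory.comp_apply, ← complexBetti.map_comp, hsq, complexBetti.map_id]
    rfl
  -- `s^* ζ` is a divisor class on `X`
  have hsζ : complexBetti.map s (2 * 1) ζ ∈ algebraicClasses X 1 :=
    Theorems.HodgeBeyondAnchors.map_mem_algebraicClasses_one hE hX s hζ
  -- `s^* y = Σ_b (s^* ζ)ᵇ ∪ x_b`
  rw [hx, map_sum]
  refine Submodule.sum_mem _ fun b _ ↦ ?_
  rw [complexBetti.map, cupProduct_map]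
  change cupProduct _ (complexBetti.map s _ (cupPow ℂ ζ b))
    (complexBetti.map s _ (complexBetti.map q _ (x b))) ∈ _
  rw [hsq']
  have hpow : complexBetti.map s (2 * (b : ℕ)) (cupPow ℂ ζ b) =
      cupPow ℂ (complexBetti.map s (2 * 1) ζ) b :=
    map_cupPow ℂ _ ζ b
  rw [hpow, cupProduct_gradedComm_holds ℂ (Motives.ComplexPoints X) _
    (show 2 * (p - (b : ℕ)) + 2 * (b : ℕ) = 2 * p by omega)]
  refine Submodule.smul_mem _ _ ?_
  exact cupProduct_cupPow_mem_algebraicClasses' hX hsζ (hxalg b) b p (by omega) (by omega)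

end SectionPullback

/-- **THE SKELETON THEOREM (primary decl).** The crux item stmt-HodgeConjecture-1071, as the decl
`Summit.HodgeConjecture.HodgeConjecture.Theses.QbarEnvelope.PullbackAlgebraic`, closed modulo exactly the
two registered stubs (axioms: their `sorryAx` only; no `sorry` outside `stub_*`): the landed
constant-lift composition `PullbackAlgebraic_of_exceptionalDivisor` (deformation to the normal cone with
the constant lift `φ^* c`, graph reduction, Deligne + Hironaka decomposition, slice homotopy) fed with the
local triviality and smooth projectivity stubs, the landed codimension bookkeeping and the section
pull-back theorem.
[Fulton1998 §5.1, §6.2, Cor. 19.2 (b); VoisinHodgeII2003 Prop. 9.21 (i)] -/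
theorem PullbackAlgebraic_proof :
    Summit.HodgeConjecture.HodgeConjecture.Theses.QbarEnvelope.PullbackAlgebraic :=
  PullbackAlgebraic_of_exceptionalDivisor stub_exceptionalDivisorLocallyTrivial'
    (stub_exceptionalDivisorSmoothProjective' stub_exceptionalDivisorLocallyTrivial')
    zbar_coheight_bookkeeping
    fun _ _ _ _ q s hX hE hsq htriv p _ hy ↦ sectionPullback' q s hX hE hsq htriv p hy

/-- **Composition for the `BoundaryReadout` decl** (the second route wanting the shared item; the
two route files carry syntactically identical `def PullbackAlgebraic`, so this is the previous
theorem up to definitional unfolding). -/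
theorem PullbackAlgebraic_of_boundaryReadout
    (h : Summit.HodgeConjecture.HodgeConjecture.Theses.QbarEnvelope.PullbackAlgebraic) :
    Summit.HodgeConjecture.HodgeConjecture.Theses.BoundaryReadout.PullbackAlgebraic :=
  fun _ _ hX _ _ hW ι p c' hc' ↦ h hX hW ι p c' hc'

/-- The `BoundaryReadout` decl of the crux, closed modulo exactly the two registered stubs. -/
theorem PullbackAlgebraic_proof_boundaryReadout :
    Summit.HodgeConjecture.HodgeConjecture.Theses.BoundaryReadout.PullbackAlgebraic :=
  PullbackAlgebraic_of_boundaryReadout PullbackAlgebraic_proof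

end Summit.HodgeConjecture.HodgeConjecture.Cruxes.PullbackAlgebraic.NormalCone

end
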